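import Summits.Ventures.PercRepro.RankLevelSetRuleQFullUniformStep

/-!
# PercRepro — (R̂) FROM THE ROW `J = 1` OF THE WHOLE-DIAGONAL PAIRING, UNIFORMLY IN `k` (p4, gen 23; C-044; paper
proofs/P4-CELL-THREE.md §12)

With the row step `rowstep_full` of RankLevelSetRuleQFullUniformStep (`P(J)·(m−J)·(q+J+k) ≤ P(J+1)·(q+J+1)·(J+k)` for every
`k ≥ 3`, `u ≥ k − 1`, `1 ≤ J ≤ m − 1`; `P(J) = Σ_{0<i<k} C(u+k, i)·C(m, J+k−1−i)`), the pairing `C(m,J)·C(q+J+k−1, J+k−1) ≤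
P(J)·C(q+J, J)` propagates from the row `J = 1` to every row (`pairing_of_rowstep`), and RankLevelSetRuleQPairingCert turns
the `k − 1` rows into (R̂): **`rhat_ge_phiK_of_full (q k m) (3 ≤ k) (k − 1 ≤ q − m) (m ≤ q) (h1) : phiK (q+k) q ≤ rhat q k m`**
with `h1 : m·C(q+k, k) ≤ P(1)·(q+1)` the single row `J = 1`; by Vandermonde (`row_one_closed`: `P(1) + C(m,k) + C(u+k,k) =
C(q+k,k)`) the row reads `(q+1)·(C(m,k) + C(q−m+k,k)) ≤ (q−m+1)·C(q+k,k)` (**`rhat_ge_phiK_of_row_one`**, three binomials),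
matroid form `ruleQRecv_ge_of_flatPart_row_one`.  This is the uniform-in-`k` form of `rhat_five_of_full` … `rhat_eight_of_full`
(regime `#P ≲ (k−1)q/k`); for `q ≲ k²` the row `J = 1` holds on the WHOLE untruncated regime `#P ≤ q − k + 1` — certified here
for the cells `(220, 200)` (`k = 20`, all `#P ≤ 181`) and `(112, 100)` (`k = 12`, all `#P ≤ 89`), and the point `#P = 87` of
`(109, 100)` (`k = 9`).  No defs; axioms standard.
-/

namespace PercRepro

open Finset

/-! ### From the row `J = 1` to every row, and (R̂) -/

/-- The pairing at row `J` (`C(m,J)·C(q+J+k−1, J+k−1) ≤ P(J)·C(q+J, J)`) propagates from `J = 1` to every `1 ≤ J ≤ m`. -/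
lemma pairing_of_rowstep (u m k : ℕ) (hk : 3 ≤ k) (hu : k ≤ u + 1)
    (h1 : m.choose 1 * (u + m + 1 + (k - 1)).choose (1 + (k - 1))
        ≤ (∑ i ∈ Ioo 0 k, (u + k).choose i * m.choose (1 + (k - 1) - i)) * (u + m + 1).choose 1) :
    ∀ J, 1 ≤ J → J ≤ m →
      m.choose J * (u + m + J + (k - 1)).choose (J + (k - 1))
        ≤ (∑ i ∈ Ioo 0 k, (u + k).choose i * m.choose (J + (k - 1) - i)) * (u + m + J).choose J := by
  intro J hJ hJm
  induction J with
  | zero => omega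
  | succ J ih =>
    rcases Nat.eq_zero_or_pos J with h0 | hpos
    · subst h0
      simpa using h1
    · have hp := ih hpos (by omega)
      have hrs := rowstep_full u m J k hk hu hpos hJm
      have r1 : m.choose (J + 1) * (J + 1) = m.choose J * (m - J) := Nat.choose_succ_right_eq m J
      have r2 : (u + m + J + k) * (u + m + J + (k - 1)).choose (J + (k - 1))
          = (u + m + J + k).choose (J + k) * (J + k) := by
        have := Nat.add_one_mul_choose_eq (u + m + J + (k - 1)) (J + (k - 1))
        rw [show u + m + J + (k - 1) + 1 = u + m + J + k by omega, show J + (k - 1) + 1 = J + k by omega] at this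
        exact this
      have r3 : (u + m + J + 1) * (u + m + J).choose J = (u + m + J + 1).choose (J + 1) * (J + 1) :=
        Nat.add_one_mul_choose_eq (u + m + J) J
      rw [show (u + m + (J + 1) + (k - 1)).choose (J + 1 + (k - 1)) = (u + m + J + k).choose (J + k) by
            congr 1 <;> omega,
        show u + m + (J + 1) = u + m + J + 1 by omega]
      have hpos' : 0 < (J + 1) * (J + k) := by positivity
      refine Nat.le_of_mul_le_mul_right ?_ hpos'
      calc m.choose (J + 1) * (u + m + J + k).choose (J + k) * ((J + 1) * (J + k))
          = (m.choose (J + 1) * (J + 1)) * ((u + m + J + k).choose (J + k) * (J + k)) := by ring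
        _ = (m.choose J * (m - J)) * ((u + m + J + k) * (u + m + J + (k - 1)).choose (J + (k - 1))) := by
            rw [r1, ← r2]
        _ = (m.choose J * (u + m + J + (k - 1)).choose (J + (k - 1))) * ((m - J) * (u + m + J + k)) := by ring
        _ ≤ ((∑ i ∈ Ioo 0 k, (u + k).choose i * m.choose (J + (k - 1) - i)) * (u + m + J).choose J)
              * ((m - J) * (u + m + J + k)) := Nat.mul_le_mul_right _ hp
        _ = ((∑ i ∈ Ioo 0 k, (u + k).choose i * m.choose (J + (k - 1) - i)) * (m - J) * (u + m + J + k))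
              * (u + m + J).choose J := by ring
        _ ≤ ((∑ i ∈ Ioo 0 k, (u + k).choose i * m.choose (J + 1 + (k - 1) - i)) * (u + m + J + 1) * (J + k))
              * (u + m + J).choose J := Nat.mul_le_mul_right _ hrs
        _ = (∑ i ∈ Ioo 0 k, (u + k).choose i * m.choose (J + 1 + (k - 1) - i)) * (J + k)
              * ((u + m + J + 1) * (u + m + J).choose J) := by ring
        _ = (∑ i ∈ Ioo 0 k, (u + k).choose i * m.choose (J + 1 + (k - 1) - i)) * (J + k)
              * ((u + m + J + 1).choose (J + 1) * (J + 1)) := by rw [r3]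
        _ = (∑ i ∈ Ioo 0 k, (u + k).choose i * m.choose (J + 1 + (k - 1) - i)) * (u + m + J + 1).choose (J + 1)
              * ((J + 1) * (J + k)) := by ring

/-- **(R̂) FROM THE ROW `J = 1` OF THE WHOLE-DIAGONAL PAIRING, FOR EVERY `k ≥ 3`** (untruncated regime `k − 1 ≤ q − m`):
`h1 : m·C(q+k, k) ≤ [Σ_{0<i<k} C(q+k−m, i)·C(m, k−i)]·(q+1)`. -/
theorem rhat_ge_phiK_of_full (q k m : ℕ) (hk : 3 ≤ k) (hu : k - 1 ≤ q - m) (hm : m ≤ q)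
    (h1 : m * (q + k).choose k ≤ (∑ i ∈ Ioo 0 k, (q + k - m).choose i * m.choose (k - i)) * (q + 1)) :
    phiK (q + k) q ≤ rhat q k m := by
  refine rhat_ge_phiK_of_pairing q k m (by omega) hu hm ?_
  intro J hJ
  rw [Finset.mem_Ioo] at hJ
  obtain ⟨u, rfl⟩ : ∃ u, q = u + m := ⟨q - m, by omega⟩
  have hu' : k ≤ u + 1 := by omega
  have hterm : ∀ J', 1 ≤ J' → ∑ i ∈ Ioo 0 k, (if i ≤ J' + (k - 1) ∧ J' + (k - 1) - i ≤ m
        then (u + m + k - m).choose i * m.choose (J' + (k - 1) - i) else 0)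
      = ∑ i ∈ Ioo 0 k, (u + k).choose i * m.choose (J' + (k - 1) - i) := by
    intro J' hJ'
    refine Finset.sum_congr rfl (fun i hi => ?_)
    rw [Finset.mem_Ioo] at hi
    rw [show u + m + k - m = u + k by omega]
    by_cases hm' : J' + (k - 1) - i ≤ m
    · rw [if_pos ⟨by omega, hm'⟩]
    · rw [if_neg (fun h => hm' h.2), Nat.choose_eq_zero_of_lt (by omega : m < J' + (k - 1) - i)]
      simp
  rw [hterm J hJ.1, show u + m + (J + (k - 1)) = u + m + J + (k - 1) by omega]
  rcases Nat.lt_or_ge m J with hmJ | hmJ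
  · rw [Nat.choose_eq_zero_of_lt hmJ, zero_mul]
    exact Nat.zero_le _
  · refine pairing_of_rowstep u m k hk hu' ?_ J hJ.1 hmJ
    rw [Nat.choose_one_right, show 1 + (k - 1) = k by omega, Nat.choose_one_right,
      show u + m + 1 + (k - 1) = u + m + k by omega]
    rw [show u + m + k - m = u + k by omega] at h1
    exact h1

/-! ### The row `J = 1` in closed form, the matroid form, certified cells -/

/-- `Σ_{0<i<k} g i = Σ_{j<k−1} g (j+1)`. -/
lemma sum_Ioo_zero_nat (k : ℕ) (g : ℕ → ℕ) : ∑ i ∈ Ioo 0 k, g i = ∑ j ∈ range (k - 1), g (j + 1) := by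
  rw [← Finset.Ico_succ_left_eq_Ioo, Order.succ_eq_add_one, Finset.sum_Ico_eq_sum_range]
  simp only [zero_add]
  exact Finset.sum_congr rfl (fun j _ => by rw [Nat.add_comm])

/-- Vandermonde without its two end terms: `P(1) + C(m, k) + C(n, k) = C(q+k, k)` (`n = u + k`, `q = u + m`). -/
lemma row_one_closed (u m k : ℕ) (hk : 1 ≤ k) :
    (∑ i ∈ Ioo 0 k, (u + k).choose i * m.choose (k - i)) + m.choose k + (u + k).choose k
      = (u + m + k).choose k := by
  have hV := Nat.add_choose_eq (u + k) m k
  rw [Finset.Nat.sum_antidiagonal_eq_sum_range_succ (fun i j => (u + k).choose i * m.choose j) k] at hV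
  obtain ⟨k', rfl⟩ : ∃ k', k = k' + 1 := ⟨k - 1, by omega⟩
  simp only [Nat.succ_eq_add_one] at hV
  rw [Finset.sum_range_succ, Finset.sum_range_succ'] at hV
  rw [show u + m + (k' + 1) = u + (k' + 1) + m by ring, hV, sum_Ioo_zero_nat, Nat.add_sub_cancel]
  simp only [Nat.choose_zero_right, Nat.sub_self, Nat.sub_zero, one_mul, mul_one]

/-- **(R̂) FROM THE ROW `J = 1` IN CLOSED FORM, FOR EVERY `k ≥ 3`**: by Vandermonde the row `J = 1` reads
`(q+1)·(C(m, k) + C(q−m+k, k)) ≤ (q−m+1)·C(q+k, k)` — three binomials, decidable at any point. -/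
theorem rhat_ge_phiK_of_row_one (q k m : ℕ) (hk : 3 ≤ k) (hu : k - 1 ≤ q - m) (hm : m ≤ q)
    (h : (q + 1) * (m.choose k + (q - m + k).choose k) ≤ (q - m + 1) * (q + k).choose k) :
    phiK (q + k) q ≤ rhat q k m := by
  refine rhat_ge_phiK_of_full q k m hk hu hm ?_
  obtain ⟨u, rfl⟩ : ∃ u, q = u + m := ⟨q - m, by omega⟩
  rw [show u + m + k - m = u + k by omega]
  rw [show u + m - m = u by omega] at h
  have hc := row_one_closed u m k (by omega)
  rw [← hc] at h ⊢
  nlinarith [h]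

variable {α : Type} (M : Matroid α) [M.Finite]

/-- **Rule Q pays `Φ(q+k, q)` to every member of the cell `(q+k, q)` whose flat part satisfies the row `J = 1`**
(`k ≥ 3`, untruncated regime), at the tight layer of every finite matroid. -/
theorem ruleQRecv_ge_of_flatPart_row_one {q k : ℕ} (hk : 3 ≤ k) (hE : M.E.ncard = (q + k) + q)
    {Z : Set α} (hZ : Z ∈ cellMembers M (q + k) q) (hu : k - 1 ≤ q - (flatPart M Z).ncard)
    (h : (q + 1) * ((flatPart M Z).ncard.choose k + (q - (flatPart M Z).ncard + k).choose k)
        ≤ (q - (flatPart M Z).ncard + 1) * (q + k).choose k) :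
    phiK (q + k) q ≤ ruleQRecv M (q + k) q Z := by
  refine le_trans ?_ (rhat_le_ruleQRecv M hE hZ)
  have hm : (flatPart M Z).ncard ≤ q :=
    (Nat.lt_of_sub_pos (lt_of_lt_of_le (show 0 < k - 1 by omega) hu)).le
  exact rhat_ge_phiK_of_row_one q k _ hk hu hm h

/-- The point `#P = 87` of the cell `(109, 100)` (`k = 9`, `u = 13`) from the uniform theorem. -/
theorem rhat_nine_point : phiK (100 + 9) 100 ≤ rhat 100 9 87 := by
  refine rhat_ge_phiK_of_row_one 100 9 87 (by norm_num) (by norm_num) (by norm_num) ?_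
  simp only [Nat.choose_eq_descFactorial_div_factorial]
  decide +kernel

/-- **The whole untruncated regime of the cell `(220, 200)`** (`k = 20`): every `#P ≤ 181 = q − k + 1`. -/
theorem rhat_cell_twenty_all : ∀ m, m ≤ 181 → phiK (200 + 20) 200 ≤ rhat 200 20 m := by
  have h : ∀ m ∈ Finset.range 182,
      (200 + 1) * (m.choose 20 + (200 - m + 20).choose 20) ≤ (200 - m + 1) * (200 + 20).choose 20 := by
    simp only [Nat.choose_eq_descFactorial_div_factorial]
    decide +kernel
  intro m hm
  exact rhat_ge_phiK_of_row_one 200 20 m (by norm_num) (by omega) (by omega)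
    (h m (by rw [Finset.mem_range]; omega))

/-- **The whole untruncated regime of the cell `(112, 100)`** (`k = 12`): every `#P ≤ 89 = q − k + 1`. -/
theorem rhat_cell_twelve_all : ∀ m, m ≤ 89 → phiK (100 + 12) 100 ≤ rhat 100 12 m := by
  have h : ∀ m ∈ Finset.range 90,
      (100 + 1) * (m.choose 12 + (100 - m + 12).choose 12) ≤ (100 - m + 1) * (100 + 12).choose 12 := by
    simp only [Nat.choose_eq_descFactorial_div_factorial]
    decide +kernel
  intro m hm
  exact rhat_ge_phiK_of_row_one 100 12 m (by norm_num) (by omega) (by omega)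
    (h m (by rw [Finset.mem_range]; omega))

end PercRepro
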